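import Literature.Analysis.FluidPDE.CollisionalTransferFunctional
import Literature.Analysis.FluidPDE.CollisionalTransferFunctionalMeasurable
import Literature.MathematicalPhysics.KineticTheory.HardSphereEulerProofs
import Summits.AtomisticToContinuum.HydrodynamicLimit.Theorems.RelayRaceLocalityRestartPrincipleMmrEnergyHypConst
import Summits.AtomisticToContinuum.HydrodynamicLimit.Theorems.RelayRaceLocalityRestartPrincipleMmrFluxConst
import Summits.AtomisticToContinuum.HydrodynamicLimit.Theorems.RelayRaceLocalityRestartPrincipleMmrEnergy
import Summits.AtomisticToContinuum.HydrodynamicLimit.Theorems.JParityClosureCollisionTightnessDomination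
import HarnessLib

/-!
# Stub FLUX `stub_collisionEnergyExchangeMeanBound` of crux `MeanFluxClosure`
# (stmt-AtomisticToContinuum-9256, route AnnealedZeroHorizon, line `registered`) — the provable parts

The stub asks, for the windowed ABSOLUTE ENERGY-JUMP functional of the hard-sphere flow
`𝒮ᴱ(z) = Σ_{t_c ∈ (t₁,t₂]} Σ_{(i,j) colliding} |‖vᵢ⁺‖² − ‖vᵢ⁻‖²|/2` (Literature
`HardSphereFlow.collisionalTransferFunctional` of the time-`t₁` point over `(0, t₂ − t₁]` with the kernel
`(i, j, z⁻, z⁺) ↦ |‖vᵢ⁺‖² − ‖vᵢ⁻‖²|/2`), that `Q = σ_N (N+1)⁻¹ 𝒮ᴱ` be integrable with `E Q ≤ C` eventually in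
`N` under the TRUE (non-stationary) local Gibbs law. Out of equilibrium the mean bound is an open
two-particle contact statistic; this file lands what IS provable, for `𝒮ᴱ` and for its companion the
windowed RELATIVE-SPEED functional (kernel `(i, j, z⁻, z⁺) ↦ ‖vᵢ⁻ − vⱼ⁻‖`), which dominate the collisional
momentum / energy transfers of the sibling stubs CS / CE:

* measurability in the datum of both functionals (windows from `0`, indicator of the good set; the
  kernels are continuous functions of the collision mark, `CollisionalTransferFunctionalMeasurable`) and
  a.e.-measurability of the shifted window `(t₁, t₂]` by the cocycle over the group law;
* PATHWISE: on a good orbit each functional is dominated by the inline collision sum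
  `Σᶠ_{r ∈ [0,τ]} Σᵢ Σ_k 𝟙{contact} M` of the tree's mean collision-flux bounds, with the energy mark
  `M = ‖vᵢ − v_k‖ (‖vᵢ‖ + ‖v_k‖)` (`mmr_abs_norm_sq_vel_sub_leftLim_le`) resp. the relative speed
  `‖vᵢ − v_k‖` (a collision invariant), read AFTER the collision;
* CONSTANT PROFILES (homogeneous Gibbs law `G_N`, every `0 < σ ≤ 1/2`, every flow, EVERY `N`): both
  functionals of the time-`t₁` point are integrable with
  `(ε_N/(N+1)) E_{G_N}[𝒮ᴱ] ≤ 160 σ³ (1 + 8(‖u‖⁴ + 15θ²)) (t₂ − t₁)`,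
  `(ε_N/(N+1)) E_{G_N}[Σ ‖vᵢ⁻ − vⱼ⁻‖] ≤ 80 σ³ (3θ + ‖u‖²) (t₂ − t₁)` — flow invariance
  `(Φ_{t₁})_* G_N = G_N` (`map_flow_localGibbsLaw_const`) moves the window to `(0, t₂ − t₁]`, where
  `mmr_energyCollisionFlux_const` / `mmr_collisionFlux_const` (Cercignani–Illner–Pulvirenti one-window
  inequality + Gaussian moments) apply;
* GENERAL continuous profiles, EVERY `N`: INTEGRABILITY of both functionals under
  `localGibbsLaw σ a₀ u₀ θ₀ N Φ` by the domination
  `localGibbsMeasure σ a₀ u₀ θ₀ N ≤ Λ^{N+1} • localGibbsMeasure σ 1 0 θ₁ N` (`exists_localGibbsMeasure_le_smul_const`).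
  The constant `Λ^{N+1}` is why this gives no mean bound uniform in `N`.

References: C. Cercignani, R. Illner, M. Pulvirenti, *The Mathematical Theory of Dilute Gases* (1994)
App. 4.A; H. Spohn, *Large Scale Dynamics of Interacting Particles* (1991) Part I §2.3, (3.8).
-/

noncomputable section

namespace Summit.AtomisticToContinuum.HydrodynamicLimit.Theorems

open scoped BigOperators ENNReal Topology InnerProductSpace
open MeasureTheory Set Filter
open Literature.MathematicalPhysics.KineticTheory Literature.Analysis.FluidPDE Literature.Analysis.FunctionSpaces
open Summit.AtomisticToContinuum.HydrodynamicLimit.Theorems.RestartPrinciple.AgeDuhamelForgetting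

namespace CollisionEnergyExchangeMeanBound

variable {ε : ℝ} {n : ℕ}

/-! ## Measurability of the two windowed collision functionals in the initial datum -/

/-- On `𝕋³` with `ε < 1/2`, the windowed ABSOLUTE ENERGY-JUMP functional
`𝒮ᴱ(z; (0, h]) = Σ_{t_c ∈ (0,h]} Σ_{(i,j) colliding} |‖vᵢ⁺‖² − ‖vᵢ⁻‖²|/2` along the flow, extended by `0` off the
good set, is measurable in the datum: its kernel is the continuous mark function
`(t, x, ω, v, w) ↦ |‖v − ⟪v − w, ω⟫ω‖² − ‖v‖²|/2`. [folklore] -/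
theorem measurable_indicator_absEnergyJumpFunctional (Φ : HardSphereFlow (Torus.geometry (Fin 3)) ε n)
    (hε : ε < 2⁻¹) (h : ℝ) :
    Measurable (Φ.good.indicator fun z => Φ.collisionalTransferFunctional
      (fun (i _j : Fin n) (pre post : Config n (Fin 3) T3) => |‖(post i).2‖ ^ 2 - ‖(pre i).2‖ ^ 2| / 2) z h) := by
  have hG := Torus.isHardSphereRegular_geometry (d := Fin 3) hε
  refine Φ.measurable_indicator_of_eqOn_collisionSum hG Torus.isMeasurable_geometry
    (f := fun m : ℝ × T3 × V3 × V3 × V3 =>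
      |‖m.2.2.2.1 - ⟪m.2.2.2.1 - m.2.2.2.2, m.2.2.1⟫_ℝ • m.2.2.1‖ ^ 2 - ‖m.2.2.2.1‖ ^ 2| / 2) ?_ ?_ h
    fun z hz => ?_
  · have hv : Continuous fun m : ℝ × T3 × V3 × V3 × V3 => m.2.2.2.1 := by fun_prop
    exact (((continuous_markPostVel (X := T3) (d := Fin 3)).norm.pow 2).sub (hv.norm.pow 2)).abs.div_const 2
  · have hv : Measurable fun m : ℝ × T3 × V3 × V3 × V3 => m.2.2.2.1 := measurable_snd.snd.snd.fst
    have hd : Measurable fun m : ℝ × T3 × V3 × V3 × V3 =>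
        ‖m.2.2.2.1 - ⟪m.2.2.2.1 - m.2.2.2.2, m.2.2.1⟫_ℝ • m.2.2.1‖ ^ 2 - ‖m.2.2.2.1‖ ^ 2 :=
      ((measurable_markPostVel (X := T3) (d := Fin 3)).norm.pow_const 2).sub (hv.norm.pow_const 2)
    exact (continuous_abs.measurable.comp hd).div_const 2
  · refine Φ.collisionalTransferFunctional_eq_collisionSum hG fun t _ p hp => ?_
    have htraj := Φ.isTrajectory z hz
    simp only [HardSphereCollisionRecord.mark_def]
    rw [← htraj.vel_eq_preVel_sub_inner_smul_impactVec hG hp, htraj.ofConfig_preVel_eq_leftLim hp]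

/-- On `𝕋³` with `ε < 1/2`, the windowed RELATIVE-SPEED functional `Σ_{t_c ∈ (0,h]} Σ_{(i,j) colliding} ‖vᵢ⁻ − vⱼ⁻‖`
along the flow (pre-collisional relative speed of the ordered colliding pair), extended by `0` off the good
set, is measurable in the datum: its kernel is the continuous mark function `(t, x, ω, v, w) ↦ ‖v − w‖`.
[folklore] -/
theorem measurable_indicator_relSpeedFunctional (Φ : HardSphereFlow (Torus.geometry (Fin 3)) ε n)
    (hε : ε < 2⁻¹) (h : ℝ) :
    Measurable (Φ.good.indicator fun z => Φ.collisionalTransferFunctional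
      (fun (i j : Fin n) (pre _post : Config n (Fin 3) T3) => ‖(pre i).2 - (pre j).2‖) z h) := by
  have hG := Torus.isHardSphereRegular_geometry (d := Fin 3) hε
  refine Φ.measurable_indicator_of_eqOn_collisionSum hG Torus.isMeasurable_geometry
    (f := fun m : ℝ × T3 × V3 × V3 × V3 => ‖m.2.2.2.1 - m.2.2.2.2‖) ?_ ?_ h fun z hz => ?_
  · fun_prop
  · exact (measurable_snd.snd.snd.fst.sub measurable_snd.snd.snd.snd).norm
  · refine Φ.collisionalTransferFunctional_eq_collisionSum hG fun t _ p hp => ?_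
    have htraj := Φ.isTrajectory z hz
    simp only [HardSphereCollisionRecord.mark_def]
    rw [htraj.ofConfig_preVel_eq_leftLim hp]

/-! ## Pathwise facts: one particle, nonnegativity, cocycle, kernels dominated by marks -/

/-- With at most one particle there are no colliding pairs. [folklore] -/
theorem collidingPairs_eq_empty_of_le_one {X : Type*} (G : Geometry (Fin 3) X) (ε : ℝ) (hn : n ≤ 1)
    (z : Config n (Fin 3) X) : collidingPairs G ε z = ∅ :=
  Finset.eq_empty_iff_forall_notMem.2 fun p hp =>
    (mem_collidingPairs.1 hp).1 (Fin.ext (by have := p.1.2; have := p.2.2; omega))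

/-- With at most one particle every collision-indexed functional along the flow vanishes identically.
[folklore] -/
theorem collisionalTransferFunctional_eq_zero_of_le_one (Φ : HardSphereFlow (Torus.geometry (Fin 3)) ε n)
    (hn : n ≤ 1) (g : Fin n → Fin n → Config n (Fin 3) T3 → Config n (Fin 3) T3 → ℝ) (w : Config n (Fin 3) T3)
    (τ : ℝ) : Φ.collisionalTransferFunctional g w τ = 0 := by
  rw [HardSphereFlow.collisionalTransferFunctional_eq, collisionalTransferFunctional_def]
  exact finsum_mem_of_eqOn_zero fun t _ => by rw [collidingPairs_eq_empty_of_le_one _ _ hn, Finset.sum_empty]; rfl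

/-- A collision-indexed functional with a nonnegative kernel is nonnegative (every datum and window, junk
values included). [folklore] -/
theorem collisionalTransferFunctional_nonneg (Φ : HardSphereFlow (Torus.geometry (Fin 3)) ε n)
    {g : Fin n → Fin n → Config n (Fin 3) T3 → Config n (Fin 3) T3 → ℝ} (hg : ∀ i j pre post, 0 ≤ g i j pre post)
    (w : Config n (Fin 3) T3) (τ : ℝ) : 0 ≤ Φ.collisionalTransferFunctional g w τ := by
  rw [HardSphereFlow.collisionalTransferFunctional_eq, collisionalTransferFunctional_def]
  exact finsum_nonneg fun t => finsum_nonneg fun _ => Finset.sum_nonneg fun p _ => hg _ _ _ _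

/-- **Cocycle, shifted-window form**: on the good set, for `0 ≤ t₁ ≤ t₂`, the functional of the time-`t₁`
point over `(0, t₂ − t₁]` is the difference of the functionals of the datum over `(0, t₂]` and `(0, t₁]`.
[folklore] -/
theorem collisionalTransferFunctional_flow_eq_sub (Φ : HardSphereFlow (Torus.geometry (Fin 3)) ε n)
    (g : Fin n → Fin n → Config n (Fin 3) T3 → Config n (Fin 3) T3 → ℝ) {z : Config n (Fin 3) T3}
    (hz : z ∈ Φ.good) {t₁ t₂ : ℝ} (h₁ : 0 ≤ t₁) (h₁₂ : t₁ ≤ t₂) :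
    Φ.collisionalTransferFunctional g (Φ.flow t₁ z) (t₂ - t₁) =
      Φ.collisionalTransferFunctional g z t₂ - Φ.collisionalTransferFunctional g z t₁ := by
  have h := Φ.collisionalTransferFunctional_add (fun x => continuous_const.add Torus.continuous_proj) g hz h₁
    (sub_nonneg.2 h₁₂)
  rw [add_sub_cancel] at h
  linarith

/-- **A.e.-measurability of the shifted-window functional** under any law carried by the good set, from
measurability of the indicator forms of the windows from `0` (cocycle). [folklore] -/
theorem aemeasurable_collisionalTransferFunctional_flow (Φ : HardSphereFlow (Torus.geometry (Fin 3)) ε n)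
    {g : Fin n → Fin n → Config n (Fin 3) T3 → Config n (Fin 3) T3 → ℝ}
    (hgm : ∀ h : ℝ, Measurable (Φ.good.indicator fun z => Φ.collisionalTransferFunctional g z h))
    {t₁ t₂ : ℝ} (h₁ : 0 ≤ t₁) (h₁₂ : t₁ ≤ t₂) {μ : Measure (Config n (Fin 3) T3)} (hμ : μ Φ.goodᶜ = 0) :
    AEMeasurable (fun z => Φ.collisionalTransferFunctional g (Φ.flow t₁ z) (t₂ - t₁)) μ := by
  have hae : ∀ᵐ z ∂μ, z ∈ Φ.good := by rw [ae_iff]; exact hμ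
  refine ((Φ.aemeasurable_of_measurable_indicator (hgm t₂) hμ).sub
    (Φ.aemeasurable_of_measurable_indicator (hgm t₁) hμ)).congr ?_
  filter_upwards [hae] with z hz
  exact (collisionalTransferFunctional_flow_eq_sub Φ g hz h₁ h₁₂).symm

/-- **Kernel dominated by a mark ⇒ functional dominated by the inline collision sum.** On `𝕋³` with
`ε < 1/2` (colliding pairs are the ordered contact pairs), if at every collision of a hard-sphere trajectory
the kernel of the ordered contact pair `(i, j)` is at most a nonnegative mark `M` of the post-collisional
configuration, then along every good orbit the functional over `(0, τ]` is at most the inline collision sum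
`Σᶠ_{r ∈ [0,τ]} Σᵢ Σ_k 𝟙{contact} M(Φ_r w, i, k)` of the tree's mean collision-flux bounds. [folklore] -/
theorem collisionalTransferFunctional_le_finsum_ite (Φ : HardSphereFlow (Torus.geometry (Fin 3)) ε n)
    (hε : ε < 2⁻¹) {g : Fin n → Fin n → Config n (Fin 3) T3 → Config n (Fin 3) T3 → ℝ}
    {M : Config n (Fin 3) T3 → Fin n → Fin n → ℝ} (hM : ∀ w i k, 0 ≤ M w i k)
    (hgM : ∀ {γ : ℝ → Config n (Fin 3) T3}, IsHardSphereTrajectory (Torus.geometry (Fin 3)) ε n γ →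
      ∀ t : ℝ, ∀ p ∈ contactPairs (Torus.geometry (Fin 3)) ε (γ t), g p.1 p.2 (Function.leftLim γ t) (γ t) ≤ M (γ t) p.1 p.2)
    {w : Config n (Fin 3) T3} (hw : w ∈ Φ.good) (τ : ℝ) :
    Φ.collisionalTransferFunctional g w τ ≤
      ∑ᶠ r ∈ collisionTimes (Torus.geometry (Fin 3)) ε (fun t => Φ.flow t w) ∩ Icc 0 τ, ∑ i, ∑ k,
        (if i ≠ k ∧ ‖(Torus.geometry (Fin 3)).sepVec (Φ.flow r w i).1 (Φ.flow r w k).1‖ = ε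
          then M (Φ.flow r w) i k else 0) := by
  have hG := Torus.isHardSphereRegular_geometry (d := Fin 3) hε
  have htraj := Φ.isTrajectory w hw
  have hfin := htraj.finite_collisionTimes_inter_Ioc 0 τ
  rw [← Φ.collisionPairSum_eq_finsum_ite hw (Icc 0 τ) (fun _ w' i k => M w' i k)]
  refine le_trans ?_ (mmr_collisionPairSum_Ioc_le_Icc htraj τ fun _ _ _ => hM _ _ _)
  rw [HardSphereFlow.collisionalTransferFunctional_eq, collisionalTransferFunctional_eq_sum _ hfin,
    collisionPairSum_eq_finset_sum hfin]
  refine Finset.sum_le_sum fun t _ => ?_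
  rw [collidingPairs_eq_contactPairs hG]
  exact Finset.sum_le_sum fun p hp => hgM htraj t p hp

/-- **The absolute energy jump of one particle is dominated by the energy mark**: at an ordered contact pair
`(i, j)` of a collision, `|‖vᵢ⁺‖² − ‖vᵢ⁻‖²|/2 ≤ ‖vᵢ⁺ − vⱼ⁺‖ (‖vᵢ⁺‖ + ‖vⱼ⁺‖)` (post-collisional velocities;
`mmr_abs_norm_sq_vel_sub_leftLim_le`). [folklore] -/
theorem absEnergyJumpKernel_le_mark {γ : ℝ → Config n (Fin 3) T3}
    (h : IsHardSphereTrajectory (Torus.geometry (Fin 3)) ε n γ) (t : ℝ) (p : Fin n × Fin n)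
    (hp : p ∈ contactPairs (Torus.geometry (Fin 3)) ε (γ t)) :
    |‖(γ t p.1).2‖ ^ 2 - ‖(Function.leftLim γ t p.1).2‖ ^ 2| / 2 ≤
      ‖(γ t p.1).2 - (γ t p.2).2‖ * (‖(γ t p.1).2‖ + ‖(γ t p.2).2‖) := by
  obtain ⟨hne, hc⟩ := mem_contactPairs.1 hp
  have := mmr_abs_norm_sq_vel_sub_leftLim_le h hne hc
  linarith

/-- **The pre-collisional relative speed IS the post-collisional one**: at an ordered contact pair `(i, j)`
of a collision, `‖vᵢ⁻ − vⱼ⁻‖ = ‖vᵢ⁺ − vⱼ⁺‖` (the elastic reflection preserves the modulus of the relative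
velocity). [folklore] -/
theorem relSpeedKernel_eq_mark {γ : ℝ → Config n (Fin 3) T3}
    (h : IsHardSphereTrajectory (Torus.geometry (Fin 3)) ε n γ) (t : ℝ) (p : Fin n × Fin n)
    (hp : p ∈ contactPairs (Torus.geometry (Fin 3)) ε (γ t)) :
    ‖(Function.leftLim γ t p.1).2 - (Function.leftLim γ t p.2).2‖ = ‖(γ t p.1).2 - (γ t p.2).2‖ := by
  obtain ⟨hne, hc⟩ := mem_contactPairs.1 hp
  rw [h.leftLim_eq_collidePair hne hc, collidePair_apply_left hne, collidePair_apply_right, norm_sub_rev,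
    norm_snd_sub_fst_reflectVel, norm_sub_rev]

/-! ## Constant profiles: mean bounds through the flow invariance of the homogeneous Gibbs law -/

/-- **Generic mean bound at constant profiles.** For `0 < σ ≤ 1/2`, `N ≥ 1` (so `ε_N < 1/2`), a flow `Φ`,
the homogeneous Gibbs law `G_N = localGibbsLaw σ a u θ N Φ`, a nonnegative kernel `g` whose windows from `0`
are measurable in the datum and which is dominated at collisions by a nonnegative mark `M`, and a mean
collision-flux bound `(ε_N/(N+1)) E_{G_N}[Σᶠ_{[0,s]} 𝟙{contact} M] ≤ K s` (`s > 0`; the tree's `mmr_…_const`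
bounds), the functional of the time-`t₁` point over `(0, t₂ − t₁]` is integrable under `G_N` with
`(ε_N/(N+1)) E_{G_N}[W_g(Φ_{t₁} z; (0, t₂ − t₁])] ≤ K (t₂ − t₁)`: flow invariance `(Φ_{t₁})_* G_N = G_N`
(`map_flow_localGibbsLaw_const`) moves the window to `(0, t₂ − t₁]`, where the pathwise domination and
the flux bound apply; integrability from the finite lower integral of a nonnegative a.e.-measurable function.
[folklore] -/
theorem const_integrable_and_integral_le {σ : ℝ} (hσ : 0 < σ) (hσ2 : σ ≤ 1 / 2) (a θ : ℝ) (u : V3)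
    {N : ℕ} (hN : 1 ≤ N) (Φ : HardSphereFlow (Torus.geometry (Fin 3)) (hsDiameter σ N) (N + 1))
    {g : Fin (N + 1) → Fin (N + 1) → Config (N + 1) (Fin 3) T3 → Config (N + 1) (Fin 3) T3 → ℝ}
    (hg0 : ∀ i j pre post, 0 ≤ g i j pre post)
    (hgm : ∀ h : ℝ, Measurable (Φ.good.indicator fun z => Φ.collisionalTransferFunctional g z h))
    {M : Config (N + 1) (Fin 3) T3 → Fin (N + 1) → Fin (N + 1) → ℝ} (hM : ∀ w i k, 0 ≤ M w i k)
    (hgM : ∀ {γ : ℝ → Config (N + 1) (Fin 3) T3},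
      IsHardSphereTrajectory (Torus.geometry (Fin 3)) (hsDiameter σ N) (N + 1) γ →
      ∀ t : ℝ, ∀ p ∈ contactPairs (Torus.geometry (Fin 3)) (hsDiameter σ N) (γ t),
        g p.1 p.2 (Function.leftLim γ t) (γ t) ≤ M (γ t) p.1 p.2)
    {K : ℝ} (hK : 0 ≤ K)
    (hmean : ∀ s : ℝ, 0 < s → ENNReal.ofReal (hsDiameter σ N / ((N + 1 : ℕ) : ℝ)) *
      ∫⁻ z, (∑ᶠ r ∈ collisionTimes (Torus.geometry (Fin 3)) (hsDiameter σ N) (fun t => Φ.flow t z) ∩ Icc 0 s,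
        ∑ i, ∑ k, (if i ≠ k ∧ ‖(Torus.geometry (Fin 3)).sepVec (Φ.flow r z i).1 (Φ.flow r z k).1‖ = hsDiameter σ N
          then ENNReal.ofReal (M (Φ.flow r z) i k) else 0))
        ∂(localGibbsLaw σ (fun _ => a) (fun _ => u) (fun _ => θ) N Φ) ≤ ENNReal.ofReal (K * s))
    {t₁ t₂ : ℝ} (h₁ : 0 ≤ t₁) (h₁₂ : t₁ ≤ t₂) :
    Integrable (fun z => Φ.collisionalTransferFunctional g (Φ.flow t₁ z) (t₂ - t₁))
        (localGibbsLaw σ (fun _ => a) (fun _ => u) (fun _ => θ) N Φ) ∧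
      hsDiameter σ N * ((N + 1 : ℕ) : ℝ)⁻¹ * ∫ z, Φ.collisionalTransferFunctional g (Φ.flow t₁ z) (t₂ - t₁)
          ∂(localGibbsLaw σ (fun _ => a) (fun _ => u) (fun _ => θ) N Φ) ≤ K * (t₂ - t₁) := by
  set G := localGibbsLaw σ (fun _ => a) (fun _ => u) (fun _ => θ) N Φ with hGdef
  set F : Config (N + 1) (Fin 3) T3 → ℝ := fun w => Φ.collisionalTransferFunctional g w (t₂ - t₁) with hFdef
  have hε : hsDiameter σ N < 2⁻¹ := (hsDiameter_lt_half_of_one_le hσ2 hN).trans_eq (one_div 2)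
  have hεpos : 0 < hsDiameter σ N := hsDiameter_pos hσ N
  have hPac : G ≪ liouville (Torus.geometry (Fin 3)) (N + 1) (hsDiameter σ N) := by
    rw [hGdef, localGibbsLaw_eq]; exact localGibbsMeasure_absolutelyContinuous σ _ _ _ N Φ
  have hgood : G Φ.goodᶜ = 0 := hPac Φ.measure_compl_good
  have hae : ∀ᵐ z ∂G, z ∈ Φ.good := hPac.ae_le Φ.ae_mem_good
  have hF0 : ∀ w, 0 ≤ F w := fun w => collisionalTransferFunctional_nonneg Φ hg0 w _
  have hQm : AEMeasurable (fun z => F (Φ.flow t₁ z)) G :=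
    aemeasurable_collisionalTransferFunctional_flow Φ hgm h₁ h₁₂ hgood
  -- the key bound, in `ℝ≥0∞`
  have hkey : ENNReal.ofReal (hsDiameter σ N / ((N + 1 : ℕ) : ℝ)) * ∫⁻ z, ENNReal.ofReal (F (Φ.flow t₁ z)) ∂G ≤
      ENNReal.ofReal (K * (t₂ - t₁)) := by
    rcases eq_or_lt_of_le h₁₂ with heq | hlt
    · have hF00 : ∀ w, F w = 0 := fun w => by
        simp only [hFdef, heq, sub_self, HardSphereFlow.collisionalTransferFunctional_zero]
      simp only [hF00, ENNReal.ofReal_zero, lintegral_const, zero_mul, mul_zero]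
      exact bot_le
    have hτ : 0 < t₂ - t₁ := sub_pos.2 hlt
    have hFm : AEMeasurable (fun w => ENNReal.ofReal (F w)) G :=
      (Φ.aemeasurable_of_measurable_indicator (hgm (t₂ - t₁)) hgood).ennreal_ofReal
    have hinv : ∫⁻ z, ENNReal.ofReal (F (Φ.flow t₁ z)) ∂G = ∫⁻ w, ENNReal.ofReal (F w) ∂G := by
      have hmap : G.map (Φ.flow t₁) = G := map_flow_localGibbsLaw_const σ a θ u N Φ t₁
      have hFm' : AEMeasurable (fun w => ENNReal.ofReal (F w)) (G.map (Φ.flow t₁)) := by rwa [hmap]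
      rw [← lintegral_map' hFm' (Φ.measurable_flow t₁).aemeasurable, hmap]
    have hpath : ∀ᵐ w ∂G, ENNReal.ofReal (F w) ≤
        ∑ᶠ r ∈ collisionTimes (Torus.geometry (Fin 3)) (hsDiameter σ N) (fun t => Φ.flow t w) ∩ Icc 0 (t₂ - t₁),
          ∑ i, ∑ k, (if i ≠ k ∧ ‖(Torus.geometry (Fin 3)).sepVec (Φ.flow r w i).1 (Φ.flow r w k).1‖ = hsDiameter σ N
            then ENNReal.ofReal (M (Φ.flow r w) i k) else 0) := by
      filter_upwards [hae] with w hw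
      rw [← mmr_ofReal_finsum_ite_eq Φ hw (t₂ - t₁) hM]
      exact ENNReal.ofReal_le_ofReal (collisionalTransferFunctional_le_finsum_ite Φ hε hM hgM hw _)
    rw [hinv]
    exact (mul_le_mul' le_rfl (lintegral_mono_ae hpath)).trans (hmean _ hτ)
  -- finiteness, integrability, the integral
  have hC0 : 0 ≤ K * (t₂ - t₁) := mul_nonneg hK (sub_nonneg.2 h₁₂)
  have hk0 : ENNReal.ofReal (hsDiameter σ N / ((N + 1 : ℕ) : ℝ)) ≠ 0 := by
    rw [Ne, ENNReal.ofReal_eq_zero, not_le]; positivity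
  have hfin : ∫⁻ z, ENNReal.ofReal (F (Φ.flow t₁ z)) ∂G < ⊤ :=
    ENNReal.lt_top_of_mul_ne_top_right (ne_top_of_le_ne_top ENNReal.ofReal_ne_top hkey) hk0
  refine ⟨⟨hQm.aestronglyMeasurable, (hasFiniteIntegral_iff_ofReal (Eventually.of_forall fun z => hF0 _)).2 hfin⟩, ?_⟩
  have h := ENNReal.toReal_le_of_le_ofReal hC0 hkey
  rw [ENNReal.toReal_mul, ENNReal.toReal_ofReal (div_nonneg hεpos.le (Nat.cast_nonneg _)), div_eq_mul_inv] at h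
  rw [integral_eq_lintegral_of_nonneg_ae (Eventually.of_forall fun z => hF0 _) hQm.aestronglyMeasurable]
  exact h

/-- **The absolute energy-jump functional at constant profiles** (deliverable (A), functional form): for
`0 < σ ≤ 1/2`, `a, θ > 0`, `u`, EVERY `N`, every flow and `0 ≤ t₁ ≤ t₂`, `z ↦ 𝒮ᴱ(Φ_{t₁} z; (0, t₂ − t₁])` is
integrable under `G_N` and `(ε_N/(N+1)) E_{G_N}[𝒮ᴱ] ≤ 160 σ³ (1 + 8(‖u‖⁴ + 15 θ²)) (t₂ − t₁)`
(`mmr_energyCollisionFlux_const`; for `N = 0` the functional vanishes identically). [folklore] -/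
theorem absEnergyJumpFunctional_flow_const {σ : ℝ} (hσ : 0 < σ) (hσ2 : σ ≤ 1 / 2) {a θ : ℝ} (u : V3)
    (ha : 0 < a) (hθ : 0 < θ) {N : ℕ} (Φ : HardSphereFlow (Torus.geometry (Fin 3)) (hsDiameter σ N) (N + 1))
    {t₁ t₂ : ℝ} (h₁ : 0 ≤ t₁) (h₁₂ : t₁ ≤ t₂) :
    Integrable (fun z => Φ.collisionalTransferFunctional (fun (i _j : Fin (N + 1)) (pre post : Config (N + 1) (Fin 3) T3) =>
        |‖(post i).2‖ ^ 2 - ‖(pre i).2‖ ^ 2| / 2) (Φ.flow t₁ z) (t₂ - t₁))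
      (localGibbsLaw σ (fun _ => a) (fun _ => u) (fun _ => θ) N Φ) ∧
    hsDiameter σ N * ((N + 1 : ℕ) : ℝ)⁻¹ * ∫ z, Φ.collisionalTransferFunctional
        (fun (i _j : Fin (N + 1)) (pre post : Config (N + 1) (Fin 3) T3) => |‖(post i).2‖ ^ 2 - ‖(pre i).2‖ ^ 2| / 2)
        (Φ.flow t₁ z) (t₂ - t₁) ∂(localGibbsLaw σ (fun _ => a) (fun _ => u) (fun _ => θ) N Φ) ≤
      160 * σ ^ 3 * (1 + 8 * (‖u‖ ^ 4 + 15 * θ ^ 2)) * (t₂ - t₁) := by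
  rcases Nat.eq_zero_or_pos N with hN0 | hN
  · subst hN0
    have h0 : ∀ z, Φ.collisionalTransferFunctional (fun (i _j : Fin (0 + 1)) (pre post : Config (0 + 1) (Fin 3) T3) =>
        |‖(post i).2‖ ^ 2 - ‖(pre i).2‖ ^ 2| / 2) (Φ.flow t₁ z) (t₂ - t₁) = 0 := fun z =>
      collisionalTransferFunctional_eq_zero_of_le_one Φ le_rfl _ _ _
    simp only [h0, integral_zero, mul_zero]
    exact ⟨integrable_zero _ _ _, mul_nonneg (by positivity) (sub_nonneg.2 h₁₂)⟩
  · have hε : hsDiameter σ N < 2⁻¹ := (hsDiameter_lt_half_of_one_le hσ2 hN).trans_eq (one_div 2)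
    exact const_integrable_and_integral_le hσ hσ2 a θ u hN Φ (fun _ _ _ _ => by positivity)
      (measurable_indicator_absEnergyJumpFunctional Φ hε)
      (M := fun w i k => ‖(w i).2 - (w k).2‖ * (‖(w i).2‖ + ‖(w k).2‖)) (fun _ _ _ => by positivity)
      (fun hγ t p hp => absEnergyJumpKernel_le_mark hγ t p hp) (by positivity)
      (mmr_energyCollisionFlux_const σ hσ hσ2 a θ u ha hθ N Φ) h₁ h₁₂

/-- **The relative-speed functional at constant profiles**: for `0 < σ ≤ 1/2`, `a, θ > 0`, `u`, EVERY `N`,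
every flow and `0 ≤ t₁ ≤ t₂`, `z ↦ Σ_{t_c ∈ (t₁,t₂]} Σ_{(i,j) colliding} ‖vᵢ⁻ − vⱼ⁻‖` (read on the orbit of the
time-`t₁` point) is integrable under `G_N` with `(ε_N/(N+1)) E_{G_N}[·] ≤ 80 σ³ (3θ + ‖u‖²) (t₂ − t₁)`
(`mmr_collisionFlux_const`). [folklore] -/
theorem relSpeedFunctional_flow_const {σ : ℝ} (hσ : 0 < σ) (hσ2 : σ ≤ 1 / 2) {a θ : ℝ} (u : V3)
    (ha : 0 < a) (hθ : 0 < θ) {N : ℕ} (Φ : HardSphereFlow (Torus.geometry (Fin 3)) (hsDiameter σ N) (N + 1))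
    {t₁ t₂ : ℝ} (h₁ : 0 ≤ t₁) (h₁₂ : t₁ ≤ t₂) :
    Integrable (fun z => Φ.collisionalTransferFunctional
        (fun (i j : Fin (N + 1)) (pre _post : Config (N + 1) (Fin 3) T3) => ‖(pre i).2 - (pre j).2‖) (Φ.flow t₁ z) (t₂ - t₁))
      (localGibbsLaw σ (fun _ => a) (fun _ => u) (fun _ => θ) N Φ) ∧
    hsDiameter σ N * ((N + 1 : ℕ) : ℝ)⁻¹ * ∫ z, Φ.collisionalTransferFunctional
        (fun (i j : Fin (N + 1)) (pre _post : Config (N + 1) (Fin 3) T3) => ‖(pre i).2 - (pre j).2‖) (Φ.flow t₁ z) (t₂ - t₁)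
        ∂(localGibbsLaw σ (fun _ => a) (fun _ => u) (fun _ => θ) N Φ) ≤ 80 * σ ^ 3 * (3 * θ + ‖u‖ ^ 2) * (t₂ - t₁) := by
  rcases Nat.eq_zero_or_pos N with hN0 | hN
  · subst hN0
    have h0 : ∀ z, Φ.collisionalTransferFunctional
        (fun (i j : Fin (0 + 1)) (pre _post : Config (0 + 1) (Fin 3) T3) => ‖(pre i).2 - (pre j).2‖)
        (Φ.flow t₁ z) (t₂ - t₁) = 0 := fun z => collisionalTransferFunctional_eq_zero_of_le_one Φ le_rfl _ _ _
    simp only [h0, integral_zero, mul_zero]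
    exact ⟨integrable_zero _ _ _, mul_nonneg (by positivity) (sub_nonneg.2 h₁₂)⟩
  · have hε : hsDiameter σ N < 2⁻¹ := (hsDiameter_lt_half_of_one_le hσ2 hN).trans_eq (one_div 2)
    exact const_integrable_and_integral_le hσ hσ2 a θ u hN Φ (fun _ _ _ _ => norm_nonneg _)
      (measurable_indicator_relSpeedFunctional Φ hε) (M := fun w i k => ‖(w i).2 - (w k).2‖) (fun _ _ _ => norm_nonneg _)
      (fun hγ t p hp => (relSpeedKernel_eq_mark hγ t p hp).le) (by positivity)
      (mmr_collisionFlux_const σ hσ hσ2 a θ u ha hθ N Φ) h₁ h₁₂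

/-- **Mean bound for the absolute energy-jump functional at constant profiles** (deliverable (A)):
`(ε_N/(N+1)) E_{G_N}[𝒮ᴱ(Φ_{t₁} z; (0, t₂ − t₁])] ≤ 160 σ³ (1 + 8(‖u‖⁴ + 15 θ²)) (t₂ − t₁)`, every `N`. [folklore] -/
theorem integral_absEnergyJumpFunctional_flow_le_const {σ : ℝ} (hσ : 0 < σ) (hσ2 : σ ≤ 1 / 2) {a θ : ℝ} (u : V3)
    (ha : 0 < a) (hθ : 0 < θ) {N : ℕ} (Φ : HardSphereFlow (Torus.geometry (Fin 3)) (hsDiameter σ N) (N + 1))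
    {t₁ t₂ : ℝ} (h₁ : 0 ≤ t₁) (h₁₂ : t₁ ≤ t₂) :
    hsDiameter σ N * ((N + 1 : ℕ) : ℝ)⁻¹ * ∫ z, Φ.collisionalTransferFunctional
        (fun (i _j : Fin (N + 1)) (pre post : Config (N + 1) (Fin 3) T3) => |‖(post i).2‖ ^ 2 - ‖(pre i).2‖ ^ 2| / 2)
        (Φ.flow t₁ z) (t₂ - t₁) ∂(localGibbsLaw σ (fun _ => a) (fun _ => u) (fun _ => θ) N Φ) ≤
      160 * σ ^ 3 * (1 + 8 * (‖u‖ ^ 4 + 15 * θ ^ 2)) * (t₂ - t₁) :=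
  (absEnergyJumpFunctional_flow_const hσ hσ2 u ha hθ Φ h₁ h₁₂).2

/-- **Mean bound for the relative-speed functional at constant profiles**:
`(ε_N/(N+1)) E_{G_N}[Σ_{t_c ∈ (t₁,t₂]} Σ_{(i,j)} ‖vᵢ⁻ − vⱼ⁻‖] ≤ 80 σ³ (3θ + ‖u‖²) (t₂ − t₁)`, every `N`. [folklore] -/
theorem integral_relSpeedFunctional_flow_le_const {σ : ℝ} (hσ : 0 < σ) (hσ2 : σ ≤ 1 / 2) {a θ : ℝ} (u : V3)
    (ha : 0 < a) (hθ : 0 < θ) {N : ℕ} (Φ : HardSphereFlow (Torus.geometry (Fin 3)) (hsDiameter σ N) (N + 1))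
    {t₁ t₂ : ℝ} (h₁ : 0 ≤ t₁) (h₁₂ : t₁ ≤ t₂) :
    hsDiameter σ N * ((N + 1 : ℕ) : ℝ)⁻¹ * ∫ z, Φ.collisionalTransferFunctional
        (fun (i j : Fin (N + 1)) (pre _post : Config (N + 1) (Fin 3) T3) => ‖(pre i).2 - (pre j).2‖) (Φ.flow t₁ z) (t₂ - t₁)
        ∂(localGibbsLaw σ (fun _ => a) (fun _ => u) (fun _ => θ) N Φ) ≤ 80 * σ ^ 3 * (3 * θ + ‖u‖ ^ 2) * (t₂ - t₁) :=
  (relSpeedFunctional_flow_const hσ hσ2 u ha hθ Φ h₁ h₁₂).2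

/-! ## General profiles: integrability at every `N` by domination -/

variable {a₀ θ₀ : T3 → ℝ} {u₀ : T3 → V3}

/-- **Integrability of the absolute energy-jump functional under the local Gibbs law** (deliverable (B)): for
continuous `a₀, θ₀ > 0`, `u₀`, `0 < σ ≤ 1/2`, EVERY `N`, every flow and `0 ≤ t₁ ≤ t₂`,
`z ↦ 𝒮ᴱ(Φ_{t₁} z; (0, t₂ − t₁])` is integrable under `localGibbsLaw σ a₀ u₀ θ₀ N Φ` — domination
`localGibbsMeasure σ a₀ u₀ θ₀ N ≤ Λ^{N+1} • localGibbsMeasure σ 1 0 θ₁ N` (`exists_localGibbsMeasure_le_smul_const`) and the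
constant-profile case. [folklore] -/
theorem integrable_absEnergyJumpFunctional_flow : ∀ {a₀ θ₀ : T3 → ℝ} {u₀ : T3 → V3}, Continuous a₀ → Continuous θ₀ → Continuous u₀ → (∀ x, 0 < a₀ x) → (∀ x, 0 < θ₀ x) → ∀ {σ : ℝ}, 0 < σ → σ ≤ 1 / 2 → ∀ {N : ℕ} (Φ : HardSphereFlow (Torus.geometry (Fin 3)) (hsDiameter σ N) (N + 1)) {t₁ t₂ : ℝ}, 0 ≤ t₁ → t₁ ≤ t₂ → Integrable (fun z => Φ.collisionalTransferFunctional (fun (i _j : Fin (N + 1)) (pre post : Config (N + 1) (Fin 3) T3) => |‖(post i).2‖ ^ 2 - ‖(pre i).2‖ ^ 2| / 2) (Φ.flow t₁ z) (t₂ - t₁)) (localGibbsLaw σ a₀ u₀ θ₀ N Φ) := by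
  intro a₀ θ₀ u₀ ha hθ hu ha0 hθ0 σ hσ hσ2 N Φ t₁ t₂ h₁ h₁₂
  obtain ⟨θ₁, hθ₁, Λ, -, hdom⟩ := exists_localGibbsMeasure_le_smul_const ha hθ hu ha0 hθ0
  have hI := (absEnergyJumpFunctional_flow_const hσ hσ2 (0 : V3) one_pos hθ₁ Φ h₁ h₁₂).1
  rw [localGibbsLaw_eq] at hI ⊢
  exact (hI.smul_measure ENNReal.ofReal_ne_top).mono_measure (hdom σ hσ2 N)

/-- **Integrability of the relative-speed functional under the local Gibbs law** (deliverable (B), companion):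
same hypotheses, `z ↦ Σ_{t_c ∈ (t₁,t₂]} Σ_{(i,j) colliding} ‖vᵢ⁻ − vⱼ⁻‖` (on the orbit of the time-`t₁` point) is
integrable under `localGibbsLaw σ a₀ u₀ θ₀ N Φ`. [folklore] -/
theorem integrable_relSpeedFunctional_flow (ha : Continuous a₀) (hθ : Continuous θ₀) (hu : Continuous u₀)
    (ha0 : ∀ x, 0 < a₀ x) (hθ0 : ∀ x, 0 < θ₀ x) {σ : ℝ} (hσ : 0 < σ) (hσ2 : σ ≤ 1 / 2) {N : ℕ}
    (Φ : HardSphereFlow (Torus.geometry (Fin 3)) (hsDiameter σ N) (N + 1)) {t₁ t₂ : ℝ} (h₁ : 0 ≤ t₁) (h₁₂ : t₁ ≤ t₂) :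
    Integrable (fun z => Φ.collisionalTransferFunctional
        (fun (i j : Fin (N + 1)) (pre _post : Config (N + 1) (Fin 3) T3) => ‖(pre i).2 - (pre j).2‖) (Φ.flow t₁ z) (t₂ - t₁))
      (localGibbsLaw σ a₀ u₀ θ₀ N Φ) := by
  obtain ⟨θ₁, hθ₁, Λ, -, hdom⟩ := exists_localGibbsMeasure_le_smul_const ha hθ hu ha0 hθ0
  have hI := (relSpeedFunctional_flow_const hσ hσ2 (0 : V3) one_pos hθ₁ Φ h₁ h₁₂).1
  rw [localGibbsLaw_eq] at hI ⊢
  exact (hI.smul_measure ENNReal.ofReal_ne_top).mono_measure (hdom σ hσ2 N)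

end CollisionEnergyExchangeMeanBound

end Summit.AtomisticToContinuum.HydrodynamicLimit.Theorems

end
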